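import Summits.BirchSwinnertonDyer.BirchSwinnertonDyer.Theorems.SchneiderFreeAdditiveX3AnticycControlAdditiveStubNoLocalPTorsionOfAtoms
import Summits.BirchSwinnertonDyer.Rank1Residual.X11b.RouteR1Coinvariants
import Summits.BirchSwinnertonDyer.Rank1Residual.X11b.RouteR1LocalKernelRecord
import Summits.BirchSwinnertonDyer.Rank1Residual.O5.HeegnerLogTransportThreeExactCount
import Summits.BirchSwinnertonDyer.Rank1Residual.Additive.LocalLogImageRat
import Summits.BirchSwinnertonDyer.Rank1Residual.Iwasawa.LocalTowerKernelCardLeTorsion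
import HarnessLib

/-!
# Crux `AnticycControlAdditive` (route `SchneiderFreeAdditiveX3`, items stmt-BirchSwinnertonDyer-19178 /
# 19295): the Poitou–Tate atoms of the `t_p = 0` half DISCHARGED modulo cited facts (part 1: atoms)

Seat `bsd-schneider-door-c4`, gen 2 (cell `bsd-schneider-ideate`). Gen 0 closed the registered stub
`stub_control_noLocalPTorsion` (the `t_p = 0` half of the crux: frames with `E(K_𝔭)[p] = 0`) MODULO four
atoms typed on the tree's constructed objects (`stub_control_noLocalPTorsion_of_atoms`): (P6-add)
`AdditiveBaseSelmerCountAt`, (P9) `X11b.LocSurjAt`, (L10) `X11b.CoinvariantsTrivialAt`, (P11)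
`X11b.R1LocalKernelOrderAt`. This file DISCHARGES all four on the additive cells, exactly as the X11b route-R1
and O5 cells discharged them on theirs, so that the `t_p = 0` half of the crux rests ONLY on published
theorems carried as NAMED cited facts (hypotheses, tree `def`s with sources):

* `kolyvagin` (Kolyvagin 1990 / Gross 1991: `rank E(K) = 1`, `Ш(E/K)` finite for a non-torsion Heegner
  point) — the antecedent of the rev-6 item `AnticycControlAdditiveK`;
* `poitouTate_selmerStructure_duality` (Milne ADT I 4.10(b) / Howard 2004 Thm. 2.1.11),
  `poitouTate_sha_tateDual` (Milne ADT I 4.10(a) / Harari 17.13), `localEulerPoincareCharacteristic`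
  (Milne ADT I 2.8), `fieldCdLE_two_of_numberField` (Serre, Galois Cohomology II §4.4 Prop. 13);
* `ZpExtension.decomp_not_le_kerSubgroup_of_isAnticyclotomic` (Brink 2007 Thm. 2 / Cor. 1: split primes
  are finitely decomposed in the anticyclotomic tower).

Ingredients (all tree theorems on the same constructed objects `selmerAc`, `selmerAcBase`, `XAc`):
(P6-add) = O5's reduction-type-free exact base count `natCard_selmerAcBase_eq_pow_of_noLocalTorsion`
(JSW17 Prop. 3.2.1 with `=`) read at an additive prime (`#Ẽ_ns(𝔽_p) = p`, `reductionPointCount_of_addv`;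
`ord_p ∏_{w∣p} c_w = 2 ord_p c_p`); (P9) = `AcSelmer.locSurjAt_of_finite` (R1 gen 15); (L10) =
`Coinv.coinvariantsTrivialAt_of_subsingleton` + `WeakLeopoldt` (R1 gen 16); (P11) =
`r1LocalKernelOrderAt_of_anticyclotomicDecomposition` (Brink, R1 gen 18/20). Hypothesis (iv) is carried
in Castella's form `E(ℚ_p)[p] = 0` and bridged to the registered stub's decomposition-group form.

This is PART 1 (the (iv)-bridges and the three Poitou–Tate atoms at a datum); part 2
(`…NoLocalPTorsionOfFacts.lean`) assembles T-B6-2′ and the registered stub. CONDITIONAL on the cited facts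
(displayed hypotheses BY NAME); no `Prop` fact minted; closes nothing by itself; BSD is not proved by any
of this. The `t_p ≥ 1` half (Fin_v + torsion-robust atoms) is untouched.

References: [JetchevSkinnerWan2017] §3.2–3.3 (arXiv:1512.06894 pp. 10–14); [Castella2018] Thm. 2.3;
[Castella2018Erratum] Thm. 1.1 (iv); [MilneADT2006] I 2.8, 4.10; [Brink2007] Thm. 2, Cor. 1;
[GreenbergLNM1716] §3–4.
-/

noncomputable section

open scoped Classical

open WeierstrassCurve NumberField IsDedekindDomain Field Literature.NumberTheory.EllipticCurves
  Literature.NumberTheory.EllipticCurves.ModularForms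
  Literature.NumberTheory.EllipticCurves.GreenbergSelmer
  Literature.NumberTheory.GaloisRepresentations
  Literature.NumberTheory.GaloisCohomology
  Literature.NumberTheory.EllipticCurves.Rank1Residual
  Literature.NumberTheory.EllipticCurves.Rank1Residual.Typed
  Summit.BirchSwinnertonDyer.Rank1Residual
  Summit.BirchSwinnertonDyer.Rank1Residual.X11b
  Summit.BirchSwinnertonDyer.Rank1Residual.X11b.AcSelmer
  Summit.BirchSwinnertonDyer.Rank1Residual.X11b.LocBridge
  Summit.BirchSwinnertonDyer.BirchSwinnertonDyer.Theorems.SchneiderFree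
  Summit.BirchSwinnertonDyer.BirchSwinnertonDyer.Theorems.SchneiderFreeControlAtoms

set_option linter.dupNamespace false

namespace Summit.BirchSwinnertonDyer.BirchSwinnertonDyer.Theorems.SchneiderFreeAdditiveX3

/-! ## §1. Hypothesis (iv) `E(ℚ_p)[p] = 0`: bridges between Castella's form and the stub's form -/

section Bridges

variable (W : WeierstrassCurve ℚ) (p : ℕ) [Fact p.Prime] {K : Type} [Field K] [NumberField K]

/-- **(iv) ⟹ the decomposition-group form of the stub**: if `E(ℚ_p)[p] = 0` then at every degree-one
`𝔭 ∣ p` of `K` no non-zero `D_𝔭`-fixed point of `E(K̄)[p^∞]` is killed by `p` (transport along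
`K_𝔭 ≃ ℚ_p`, then Galois descent `AcSelmer.eq_zero_of_fixed_decomp_of_local`).
[cite: Castella2018Erratum, Thm. 1.1 (iv) and Lemma 2.1 (pp. 1–2)] -/
theorem noFixedPTorsion_decomp_of_noPTorsionPadic
    (hiv : ∀ R : (W.baseChange ℚ_[p]).toAffine.Point, p • R = 0 → R = 0)
    (𝔭 : HeightOneSpectrum (𝓞 K)) (h𝔭 : ((p : ℕ) : 𝓞 K) ∈ 𝔭.asIdeal)
    (he : 𝔭.asIdeal.ramificationIdx (𝓞 ℚ) = 1) (hf : 𝔭.asIdeal.inertiaDeg (𝓞 ℚ) = 1) :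
    ∀ m : (W.baseChange K).geomPrimaryTorsion p,
      (∀ d ∈ decomp 𝔭, d • m = m) → p • m = 0 → m = 0 := by
  obtain ⟨e⟩ := exists_ringHom_adicCompletion_padic_of_degreeOne p 𝔭 h𝔭 he hf
  have hKv := noPTorsion_baseChange_adicCompletion_of_padic W p 𝔭 e hiv
  intro m hfix hpm
  exact eq_zero_of_fixed_decomp_of_local (W.baseChange K) p 𝔭 hKv m hfix hpm

/-- **(iv) ⟹ `E(K̄)[p^∞]^{D_𝔭 ⊓ ker κ} = 0`** for every `ℤ_p`-extension `κ` and every degree-one `𝔭 ∣ p`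
(pro-`p` descent on top of the previous bridge). [cite: Castella2018Erratum, Thm. 1.1 (iv) and Lemma 2.1 (pp. 1–2)] -/
theorem fixedPoints_decomp_inf_kerSubgroup_eq_bot_of_noPTorsionPadic [W.IsElliptic]
    (hiv : ∀ R : (W.baseChange ℚ_[p]).toAffine.Point, p • R = 0 → R = 0)
    (κ : ZpExtension K p) (𝔭 : HeightOneSpectrum (𝓞 K)) (h𝔭 : ((p : ℕ) : 𝓞 K) ∈ 𝔭.asIdeal)
    (he : 𝔭.asIdeal.ramificationIdx (𝓞 ℚ) = 1) (hf : 𝔭.asIdeal.inertiaDeg (𝓞 ℚ) = 1) :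
    FixedPoints.addSubgroup ↥(decomp 𝔭 ⊓ κ.kerSubgroup) ((W.baseChange K).geomPrimaryTorsion p) = ⊥ :=
  AcSelmer.fixedPoints_decomp_inf_kerSubgroup_eq_bot κ (W.baseChange K) 𝔭
    (noFixedPTorsion_decomp_of_noPTorsionPadic W p hiv 𝔭 h𝔭 he hf)

/-- **(iv) ⟹ `E(K̄)[p^∞]^{Γ_K} = 0`** (a `Γ_K`-fixed point is fixed by `D_𝔭 ⊓ ker κ`).
[cite: Castella2018Erratum, Thm. 1.1 (iv) (p. 1)] -/
theorem noInvariants_of_noPTorsionPadic [W.IsElliptic]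
    (hiv : ∀ R : (W.baseChange ℚ_[p]).toAffine.Point, p • R = 0 → R = 0)
    (κ : ZpExtension K p) (𝔭 : HeightOneSpectrum (𝓞 K)) (h𝔭 : ((p : ℕ) : 𝓞 K) ∈ 𝔭.asIdeal)
    (he : 𝔭.asIdeal.ramificationIdx (𝓞 ℚ) = 1) (hf : 𝔭.asIdeal.inertiaDeg (𝓞 ℚ) = 1)
    (Q : (W.baseChange K).geomPrimaryTorsion p)
    (hQ : ∀ σ : absoluteGaloisGroup K, primaryGaloisModule (W.baseChange K) p σ Q = Q) : Q = 0 := by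
  have h := fixedPoints_decomp_inf_kerSubgroup_eq_bot_of_noPTorsionPadic W p hiv κ 𝔭 h𝔭 he hf
  have hmem : Q ∈ FixedPoints.addSubgroup ↥(decomp 𝔭 ⊓ κ.kerSubgroup)
      ((W.baseChange K).geomPrimaryTorsion p) :=
    (FixedPoints.mem_addSubgroup _ _ Q).mpr fun d ↦ hQ (d : absoluteGaloisGroup K)
  rw [h] at hmem
  exact (AddSubgroup.mem_bot).mp hmem

/-- **(iv) in local Galois form**: at a degree-one `𝔭 ∣ p`, `E[p^∞]` has no non-zero
`Γ_{K_𝔭}`-invariant point. [cite: Castella2018Erratum, Thm. 1.1 (iv), Lemma 2.1 (pp. 1–2)] -/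
theorem noInvariantsAt_of_noPTorsionPadic [W.IsElliptic]
    (hiv : ∀ R : (W.baseChange ℚ_[p]).toAffine.Point, p • R = 0 → R = 0)
    (κ : ZpExtension K p) (𝔭 : HeightOneSpectrum (𝓞 K)) (h𝔭 : ((p : ℕ) : 𝓞 K) ∈ 𝔭.asIdeal)
    (he : 𝔭.asIdeal.ramificationIdx (𝓞 ℚ) = 1) (hf : 𝔭.asIdeal.inertiaDeg (𝓞 ℚ) = 1)
    (Q : (W.baseChange K).geomPrimaryTorsion p)
    (hQ : ∀ σ : absoluteGaloisGroup (𝔭.adicCompletion K),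
      GaloisRep.restrictField (𝔭.adicCompletion K) (primaryGaloisModule (W.baseChange K) p) σ Q =
        Q) : Q = 0 := by
  have h := fixedPoints_decomp_inf_kerSubgroup_eq_bot_of_noPTorsionPadic W p hiv κ 𝔭 h𝔭 he hf
  have hmem : Q ∈ FixedPoints.addSubgroup ↥(decomp 𝔭 ⊓ κ.kerSubgroup)
      ((W.baseChange K).geomPrimaryTorsion p) := by
    refine (FixedPoints.mem_addSubgroup _ _ Q).mpr fun d ↦ ?_
    obtain ⟨σ, hσ⟩ := (mem_decomp_iff 𝔭 _).mp (Subgroup.mem_inf.mp d.2).1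
    have h1 : absGaloisRestrict K (𝔭.adicCompletion K) σ • Q = Q := hQ σ
    rw [hσ] at h1
    exact h1
  rw [h] at hmem
  exact (AddSubgroup.mem_bot).mp hmem

/-- **The stub's form ⟹ (iv)** (converse bridge): if at some prime `𝔭 ∣ p` of degree one no non-zero
`D_𝔭`-fixed point of `E(K̄)[p^∞]` is killed by `p`, then `E(ℚ_p)[p] = 0`. A `p`-torsion point `R` of
`E(ℚ_p) ≃ E(K_𝔭)` (transport along `ℚ_p ≃ K_𝔭`) maps into `E(K̄_𝔭)[p]`, which comes from `E(K̄)[p]`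
(algebraicity of torsion, `exists_pointsMapOfEmb_eq_of_nsmul_eq_zero`); the preimage is `D_𝔭`-fixed
because `D_𝔭` is the image of `Γ_{K_𝔭}` and images of `K_𝔭`-rational points are `Γ_{K_𝔭}`-fixed.
[cite: SilvermanAEC2009, Cor. III.6.4(b) and VIII.§1] -/
theorem noPTorsionPadic_of_noFixedPTorsion_decomp [W.IsElliptic]
    (𝔭 : HeightOneSpectrum (𝓞 K)) (h𝔭 : ((p : ℕ) : 𝓞 K) ∈ 𝔭.asIdeal)
    (he : 𝔭.asIdeal.ramificationIdx (𝓞 ℚ) = 1) (hf : 𝔭.asIdeal.inertiaDeg (𝓞 ℚ) = 1)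
    (h0 : ∀ m : (W.baseChange K).geomPrimaryTorsion p,
      (∀ d ∈ decomp 𝔭, d • m = m) → p • m = 0 → m = 0) :
    ∀ R : (W.baseChange ℚ_[p]).toAffine.Point, p • R = 0 → R = 0 := by
  have hp : p.Prime := Fact.out
  haveI hEK : (W.baseChange K).IsElliptic := by rw [baseChange]; infer_instance
  haveI : CharZero (𝔭.adicCompletion K) :=
    charZero_of_injective_algebraMap (algebraMap K (𝔭.adicCompletion K)).injective
  -- Step 1: `E(K_𝔭)[p] = 0`
  have hKv : ∀ R : ((W.baseChange K).baseChange (𝔭.adicCompletion K)).toAffine.Point,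
      p • R = 0 → R = 0 := by
    intro R hR
    let ι₀ := closureEmb (K := K) (𝔭.adicCompletion K)
    let X : localPoints (W.baseChange K) (𝔭.adicCompletion K) :=
      show localPoints (W.baseChange K) (𝔭.adicCompletion K) from
        Affine.Point.map (IsScalarTower.toAlgHom K (𝔭.adicCompletion K)
          (AlgebraicClosure (𝔭.adicCompletion K))) R
    have hinj := WeierstrassCurve.Affine.Point.map_injective (W' := W.baseChange K)
      (IsScalarTower.toAlgHom K (𝔭.adicCompletion K) (AlgebraicClosure (𝔭.adicCompletion K)))
    have hpX : p • X = 0 := by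
      have h := congrArg (Affine.Point.map (W' := W.baseChange K)
        (IsScalarTower.toAlgHom K (𝔭.adicCompletion K) (AlgebraicClosure (𝔭.adicCompletion K))))
        hR
      rw [map_nsmul, map_zero] at h
      exact h
    obtain ⟨P, hpP, hPX⟩ :=
      exists_pointsMapOfEmb_eq_of_nsmul_eq_zero (W.baseChange K) ι₀ hp.ne_zero hpX
    -- `P` is `p`-primary torsion and `D_𝔭`-fixed
    have hPmem : P ∈ (W.baseChange K).geomPrimaryTorsion p :=
      (AddCommGroup.mem_primaryComponent).mpr ⟨1, by rw [pow_one]; exact hpP⟩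
    have hXfix : ∀ τ : absoluteGaloisGroup (𝔭.adicCompletion K), τ • X = X := fun τ ↦
      Iwasawa.smul_map_toAlgHom_eq (W.baseChange K) τ R
    have hfix : ∀ d ∈ decomp 𝔭, d • (⟨P, hPmem⟩ : (W.baseChange K).geomPrimaryTorsion p) =
        ⟨P, hPmem⟩ := by
      intro d hd
      obtain ⟨τ, hτ⟩ := (mem_decomp_iff 𝔭 _).mp hd
      apply Subtype.ext
      show d • P = P
      rw [← hτ]
      apply pointsMapOfEmb_injective (W.baseChange K) ι₀
      show pointsMapOfEmb (W.baseChange K) ι₀ (resGalOfEmb ι₀ τ • P) = _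
      rw [pointsMapOfEmb_smul, hPX]
      exact hXfix τ
    have hpm : p • (⟨P, hPmem⟩ : (W.baseChange K).geomPrimaryTorsion p) = 0 :=
      Subtype.ext (by rw [AddSubgroupClass.coe_nsmul]; exact hpP)
    have hm0 := h0 ⟨P, hPmem⟩ hfix hpm
    have hP0 : P = 0 := congrArg Subtype.val hm0
    have hX0 : X = 0 := by rw [← hPX, hP0, map_zero]
    exact hinj (by rw [map_zero]; exact hX0)
  -- Step 2: transport along `ℚ_p → K_𝔭`
  haveI : 𝔭.asIdeal.LiesOver (ratPlace p).asIdeal := ⟨by rw [← under_eq_ratPlace_of_mem h𝔭]; rfl⟩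
  let e : ℚ_[p] →+* 𝔭.adicCompletion K :=
    (Literature.NumberTheory.Automorphic.adicCompletionEquivOfDegreeOne ℚ K (ratPlace p) 𝔭 he
          hf).toRingHom.comp
      (Padic.adicCompletionEquiv (𝓞 ℚ) ⟨p, Fact.out⟩).toAlgEquiv.toRingEquiv.toRingHom
  have hW : (W.baseChange K).baseChange (𝔭.adicCompletion K) = W.baseChange (𝔭.adicCompletion K) :=
    W.map_baseChange (algebraMap K (𝔭.adicCompletion K)).toRatAlgHom
  rw [hW] at hKv
  intro R hR
  have hmap := hKv (WeierstrassCurve.Affine.Point.map e.toRatAlgHom R)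
    (by rw [← map_nsmul, hR, map_zero])
  exact WeierstrassCurve.Affine.Point.map_injective (W' := W) e.toRatAlgHom (by rw [hmap, map_zero])

end Bridges

/-! ## §2. (P6-add) from the reduction-type-free exact base count (O5) at an additive prime -/

section BaseCount

variable (W : WeierstrassCurve ℚ) [W.IsElliptic] [W.IsGloballyMinimal] (p : ℕ) [Fact p.Prime]
  {K : Type} [Field K] [NumberField K]

/-- **(P6-add) `AdditiveBaseSelmerCountAt` at a rank-one datum under (iv)** — JSW17 Prop. 3.2.1 with
`=` on Castella's `Sel_𝔭(K, E[p^∞])` at an ADDITIVE `p` split in the imaginary quadratic `K`: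
`#Sel_𝔭(K,E[p^∞]) = p^a`, `a = ord_p #Ш[p^∞] + 2(ord_p log_ω P − ord_p[E(K):ℤP]) + ord_p ∏_{w∣p} c_w` —
from O5's reduction-type-free exact count (`natCard_selmerAcBase_eq_pow_of_noLocalTorsion`: exponent
`ord_p log + ord_p c_p + ord_p #Ẽ_ns(𝔽_p) − 1`), `#Ẽ_ns(𝔽_p) = p` at an additive prime
(`reductionPointCount_of_addv`) and `ord_p ∏_{w∣p} c_w(E/K) = 2 ord_p c_p(E)`
(`padicValNat_tamagawaProductAbove_eq_two_mul`). Inputs `rank E(K) = 1`, `Ш(E/K)` finite; CONDITIONAL on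
the cited `poitouTate_selmerStructure_duality K`, `localEulerPoincareCharacteristic`.
[cite: JetchevSkinnerWan2017, Prop. 3.2.1 and (7.1.5) (arXiv:1512.06894 pp. 10–11, 16)]
[cite: MilneADT2006, Ch. I, Thm. 4.10(b) and Thm. 2.8] -/
theorem additiveBaseSelmerCountAt_of_facts
    (hiv : ∀ R : (W.baseChange ℚ_[p]).toAffine.Point, p • R = 0 → R = 0) (hadd : Addv W p)
    (hK : IsImaginaryQuadratic K) (hsplit : SplitsIn K p)
    (hPT : poitouTate_selmerStructure_duality K)
    (hEP : ∀ v : HeightOneSpectrum (𝓞 K), localEulerPoincareCharacteristic (v.adicCompletion K))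
    (hrank : (W.baseChange K).mordellWeilRank = 1) (hSha : (W.baseChange K).ShaFinite)
    (P : (W.baseChange K).toAffine.Point) (hPinf : ¬ IsOfFinAddOrder P)
    (𝔭 : HeightOneSpectrum (𝓞 K)) (h𝔭 : ((p : ℕ) : 𝓞 K) ∈ 𝔭.asIdeal)
    (he : 𝔭.asIdeal.ramificationIdx (𝓞 ℚ) = 1) (hf : 𝔭.asIdeal.inertiaDeg (𝓞 ℚ) = 1) :
    AdditiveBaseSelmerCountAt p 𝔭 (embAt K p 𝔭 h𝔭 he hf) P := by
  have hp : p.Prime := Fact.out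
  obtain ⟨hfin, a, hcard, ha⟩ :=
    O5.HeegnerLogTransport.natCard_selmerAcBase_eq_pow_of_noLocalTorsion W p hiv K hK hPT hEP hrank
      hSha P hPinf 𝔭 h𝔭 he hf
  refine ⟨a, ⟨hfin, hcard⟩, ?_⟩
  have hns : padicValNat p (reductionPointCount W p) = 1 := by
    rw [Additive.LocalLog.reductionPointCount_of_addv W p hadd, padicValNat_self]
  have htam := LocalIndexTransport.padicValNat_tamagawaProductAbove_eq_two_mul W K p hK.1 hsplit
  rw [ha, hns, htam]
  push_cast
  ring

end BaseCount

/-! ## §3. (P9) `LocSurjAt` on `Σ(N⁺)` and (L10) `CoinvariantsTrivialAt` from the cited duality facts -/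

section PoitouTate

variable (W : WeierstrassCurve ℚ) [W.IsElliptic] [W.IsGloballyMinimal] (p : ℕ) [Fact p.Prime]
  {K : Type} [Field K] [NumberField K]

omit [W.IsGloballyMinimal] in
/-- **(P9) at an additive datum** (JSW17 Prop. 3.3.2 on the constructed objects): for `K` imaginary
quadratic, (iv) `E(ℚ_p)[p] = 0`, a degree-one `𝔭 ∋ p` and another prime `𝔮 ∋ p` with `Sel_𝔮(K, E[p^∞])`
finite, `LocSurjAt (E_K) p 𝔭 Σ(N⁺)` — GIVEN the cited Poitou–Tate duality for `K` and Milne I 2.8 at the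
completions (route R1's `locSurjAt_of_finite_conj` with the A′-hypotheses replaced by (iv) alone).
[cite: JetchevSkinnerWan2017, Prop. 3.3.2 (arXiv:1512.06894 p. 11)]
[cite: MilneADT2006, Ch. I, Thm. 4.10(b) and Thm. 2.8] -/
theorem locSurjAt_of_facts (hiv : ∀ R : (W.baseChange ℚ_[p]).toAffine.Point, p • R = 0 → R = 0)
    (hK : IsImaginaryQuadratic K) (hPT : poitouTate_selmerStructure_duality K)
    (hEP : ∀ v : HeightOneSpectrum (𝓞 K), localEulerPoincareCharacteristic (v.adicCompletion K))
    (κ : ZpExtension K p) {𝔭 𝔮 : HeightOneSpectrum (𝓞 K)}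
    (h𝔭 : ((p : ℕ) : 𝓞 K) ∈ 𝔭.asIdeal) (he : 𝔭.asIdeal.ramificationIdx (𝓞 ℚ) = 1)
    (hf : 𝔭.asIdeal.inertiaDeg (𝓞 ℚ) = 1) (h𝔮 : ((p : ℕ) : 𝓞 K) ∈ 𝔮.asIdeal) (hne : 𝔮 ≠ 𝔭)
    (hfin : Finite (selmerAcBase (W.baseChange K) p 𝔮 ∅)) :
    LocSurjAt (W.baseChange K) p 𝔭 (nPlusPlaces_finite (W := W) (p := p) hK.1) := by
  haveI : IsTotallyComplex K := hK.2
  haveI := hfin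
  have hfin0 : Finite (acStructure (primaryGaloisModule (W.baseChange K) p) p 𝔮
      (∅ : Set (HeightOneSpectrum (𝓞 K)))).selmerGroup := by
    refine Nat.finite_of_card_ne_zero ?_
    rw [← natCard_selmerAcBase_eq_natCard_selmerGroup (W.baseChange K) p 𝔮 ∅]
    exact Nat.card_pos.ne'
  have hfinR : Finite (acStructure (primaryGaloisModule (W.baseChange K) p) p 𝔮
      {v | (Sum.inr v : Place K) ∈ exceptionalPlaces W K p hK.1 ∧
        ((p : ℕ) : 𝓞 K) ∉ v.asIdeal}).selmerGroup :=
    finite_selmerGroup_acStructure_of_finite_empty _ p 𝔮 _ (finite_relaxationSet hK.1) hfin0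
      fun v hv _ ↦ finite_galoisCohomology_one_primary_toLocal (W.baseChange K) p v (hEP v) hv.2
  exact locSurjAt_of_finite (W.baseChange K) p 𝔭 (exceptionalPlaces W K p hK.1) hPT
    (fun w ↦ IsTotallyComplex.isComplex w)
    (fun Q hQ ↦ noInvariants_of_noPTorsionPadic W p hiv κ 𝔭 h𝔭 he hf Q hQ) h𝔭 h𝔮 hne
    (nPlusPlaces_finite (W := W) (p := p) hK.1) (fun v hv ↦ hv.1)
    (inl_mem_exceptionalPlaces hK.1) (fun v hv ↦ inr_mem_exceptionalPlaces_of_mem hK.1 hv)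
    (fun v hv ↦ inr_mem_exceptionalPlaces_of_mem_nPlusPlaces hK.1 hv)
    (fun v hv ↦ inr_mem_exceptionalPlaces_of_not_hasGoodReductionAt hK.1 hv) hfinR

/-- **(L10) at an additive datum** (JSW17 Lemma 3.3.3 on the constructed objects): for `K` imaginary
quadratic with `p` split, (iv), a `ℤ_p`-extension `κ` with topological generator `γ`, a degree-one
`𝔭 ∋ p`, and `Sel_v(K, E[p^∞])` finite at every `v ∣ p`: `CoinvariantsTrivialAt (E_K) p κ 𝔭 γ` — GIVEN
the four cited cohomological facts (route R1's `coinvariantsTrivialAt_of_erratum` with the A′-hypotheses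
replaced by (iv) alone: weak Leopoldt `H²(K, E[p^∞]) = 0`, then descent + Poitou–Tate surgery).
[cite: JetchevSkinnerWan2017, Lemma 3.3.3 (arXiv:1512.06894 pp. 11–12)]
[cite: MilneADT2006, Ch. I, Thm. 4.10 and Thm. 2.8] [cite: SerreGaloisCohomology1997, II §4.4 Prop. 13] -/
theorem coinvariantsTrivialAt_of_facts
    (hiv : ∀ R : (W.baseChange ℚ_[p]).toAffine.Point, p • R = 0 → R = 0)
    (hK : IsImaginaryQuadratic K) (hsplit : SplitsIn K p)
    (hPT : poitouTate_selmerStructure_duality K) (hPT2 : poitouTate_sha_tateDual K)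
    (hEP : ∀ v : HeightOneSpectrum (𝓞 K), localEulerPoincareCharacteristic (v.adicCompletion K))
    (hcd : fieldCdLE_two_of_numberField)
    (κ : ZpExtension K p) {γ : absoluteGaloisGroup K} (hγ : κ.IsTopGenerator γ)
    {𝔭 : HeightOneSpectrum (𝓞 K)} (h𝔭 : ((p : ℕ) : 𝓞 K) ∈ 𝔭.asIdeal)
    (he : 𝔭.asIdeal.ramificationIdx (𝓞 ℚ) = 1) (hf : 𝔭.asIdeal.inertiaDeg (𝓞 ℚ) = 1)
    (hfin : ∀ v : HeightOneSpectrum (𝓞 K), ((p : ℕ) : 𝓞 K) ∈ v.asIdeal →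
      Finite (selmerAcBase (W.baseChange K) p v ∅)) :
    CoinvariantsTrivialAt (W.baseChange K) p κ 𝔭 γ := by
  haveI : IsTotallyComplex K := hK.2
  obtain ⟨σ, 𝔮, -, hne, h𝔮, -⟩ :=
    LocalIndexTransport.exists_conj_prime_of_splitsIn K p hK.1 hsplit h𝔭
  have hΓ𝔭 := noInvariantsAt_of_noPTorsionPadic W p hiv κ 𝔭 h𝔭 he hf
  have hΓ := Coinv.noInvariants_of_noInvariants_at (W.baseChange K) p hΓ𝔭
  have htor := exists_pow_nsmul_local_eq_zero W p hK.1 hsplit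
  haveI := hfin 𝔭 h𝔭
  have h2 := WeakLeopoldt.subsingleton_galoisCohomology_two_primary (W.baseChange K) p 𝔭 ∅ hPT2
    (fieldCdLE_two_of_isTotallyComplex hcd K p) hΓ htor
  exact Coinv.coinvariantsTrivialAt_of_subsingleton (W.baseChange K) p κ hPT hEP h𝔭 h𝔮 hne hΓ𝔭
    (hfin 𝔮 h𝔮) h2 hγ

end PoitouTate

end Summit.BirchSwinnertonDyer.BirchSwinnertonDyer.Theorems.SchneiderFreeAdditiveX3

end
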